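import Summits.CriticalPhenomena.SAWScalingLimit.Theorems.SAWLeftRightFKGLeftRightFKGDefs
import Summits.CriticalPhenomena.SAWScalingLimit.Theorems.SAWLeftRightFKGLeftRightFKGStubMeshReduction
import Summits.CriticalPhenomena.SAWScalingLimit.Theorems.SAWLeftRightFKGLeftRightFKGStubLoopWindVanish
import Summits.CriticalPhenomena.SAWScalingLimit.Theorems.SAWLeftRightFKGLeftRightFKGStubStepMonotone
import Summits.CriticalPhenomena.SAWScalingLimit.Theorems.SAWLeftRightFKGLeftRightFKGStubLensDichotomy
import Summits.CriticalPhenomena.SAWScalingLimit.Theorems.SAWLeftRightFKGLeftRightFKGStubEndpointMonotone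
import Summits.CriticalPhenomena.SAWScalingLimit.Theorems.SAWLeftRightFKGLeftRightFKGStubChebyshev
import HarnessLib

/-!
# Line `corner-localisation` of crux `LeftRightFKG` (stmt-CriticalPhenomena-11232): the reduction, assembled

Crux decl `Summit.CriticalPhenomena.SAWScalingLimit.Theses.SAWLeftRightFKG.LeftRightFKG` (left–right positive
association of the critical square-lattice SAW chord measure in a simply connected lattice domain between
boundary-adjacent endpoints). This file COMPOSES the landed stubs of the line
(`stub_meshReduction` p91183, `stub_loopWindVanish` p92266, `stub_stepMonotone` p97357, `stub_lensDichotomy` p97078,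
`stub_endpointMonotoneAux` p95405, `stub_chebyshev` p95771; vocabulary p86990) into the UNCONDITIONAL reduction

* `pa_of_corner`     : for every fugacity `x > 0`, corner positivity `Corner x` implies full left–right positive
                       association `PA x` (all crux instances, all prefix/suffix classes, all step restrictions);
* `weight_pa_of_corner` : the same read on the crux's carrier with the trivial class and no restriction;
* `stub_reduction`   : `CornerCritical → LeftRightFKG` — the crux follows from corner positivity AT `x_c`
                       (registered sub-goal `stub_reduction` of the crux item; the line's Transfer `C⁺ ⇒ crux`).

So the open content of the crux along this line is exactly `CornerCritical` (registered stub `stub_corner`): for every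
crux instance, every prefix/suffix class `cls k π m σ` and every next/previous-step restriction, the 2 × 2 "corner"
inequality `Z(Γ ∩ E ∩ F) Z(Γ) ≥ Z(Γ ∩ E) Z(Γ ∩ F)` for a next-step up-event `E` and a previous-step up-event `F` at
`x = x_c` — equivalently, total positivity of order 2 of the (at most 3 × 3) matrix of `x_c`-weighted chord sums of each
slit sub-instance indexed by (rank of first free step, rank of last free step). Nothing here spends a uniform `ε`; every
step is an exact inequality, so the vanishing margins recorded by the disprover (single-edge cuts, marked-point pairs)
are no obstruction to the reduction.

What the reduction USES (for the disprover's `_false_without_` bookkeeping): boundary adjacency of both marked points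
(`IsInst`: `Adj a a'`, `Adj b b'`, `a', b' ∈ C.support`) enters through `stub_stepMonotone` (angular rank from `a'`)
and nowhere else; simple connectivity of `{wind(C,·) ≠ 0}` enters through `stub_loopWindVanish` only; planarity through
`stub_lensDichotomy` (Jordan) and the probe-crossing characterisation of the order (`Negative.wind_nonneg_iff_wcross`).
-/

noncomputable section

open MeasureTheory
open Literature.Probability.LatticeModels Literature.Probability.RandomPlanarGeometry
open scoped Classical ENNReal

namespace Summit.CriticalPhenomena.SAWScalingLimit.Theorems.LeftRightFKG.CornerLoc

/-- **Corner positivity implies left–right positive association, at every fugacity `x > 0`** (fugacity-blind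
reduction of line `corner-localisation`): `Corner x → PA x`. Proof: `StepMonotone` holds
(`stub_stepMonotone stub_meshReduction stub_loopWindVanish`); `Corner x → EndMono x` by
`stub_endpointMonotoneAux stub_lensDichotomy`; `EndMono x → PA x` by `stub_chebyshev`. [folklore] -/
theorem pa_of_corner {x : ℝ} (hx : 0 < x) (hC : Corner x) : PA x :=
  have hSM : StepMonotone := stub_stepMonotone stub_meshReduction stub_loopWindVanish
  stub_chebyshev hSM x hx (stub_endpointMonotoneAux stub_lensDichotomy hSM x hx hC).1

/-- The reduction read on the crux's own carrier: at every fugacity `x > 0`, `Corner x` gives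
`μ(A) μ(B) ≤ μ(univ) μ(A ∩ B)` for all `≼`-up-closed `A`, `B` of every crux instance (`μ = μx x`, the `x^{|γ|}`
chord measure on `SAW.DomainSAW (dom C δ) δ a b`). [folklore] -/
theorem weight_pa_of_corner {x : ℝ} (hx : 0 < x) (hC : Corner x) (δ : ℝ) (c a b a' b' : Site 2)
    (C : (zdGraph 2).Walk c c) (hI : IsInst δ a b a' b' C)
    (A B : Set (SAW.DomainSAW (dom C δ) δ a b)) (hA : IsUp A) (hB : IsUp B) :
    μx x (dom C δ) δ a b A * μx x (dom C δ) δ a b B ≤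
      μx x (dom C δ) δ a b Set.univ * μx x (dom C δ) δ a b (A ∩ B) := by
  have key := pa_of_corner hx hC δ c a b a' b' C hI 0 (fun _ => a) 0 (fun _ => b)
    Set.univ Set.univ A B (isUpOn_of_isUp hA) (isUpOn_of_isUp hB)
    (fun h => absurd h Bool.false_ne_true) (fun h => absurd h Bool.false_ne_true)
  simpa only [restrP_zero_univ, Set.inter_univ] using key

/-- REGISTERED SUB-GOAL `stub_reduction` (the line's Transfer, assembled from its landed stubs): **corner positivity
at `x_c` implies the crux** `LeftRightFKG`. With `stub_corner : CornerCritical` this closes the crux; without it, it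
records that the crux is EQUIVALENT-IN-DIFFICULTY to the TP₂ property of the end-step matrices of slit sub-instances at
`x_c`. `0 < x_c` is the tree's hypothesis-free `SAW.criticalFugacity_pos_lt_one'`; the crux's `let Ω`, `let le` and
`SAW.weight` are `dom`, `lr`, `μx x_c` definitionally. [folklore] -/
theorem stub_reduction :
    CornerCritical → Summit.CriticalPhenomena.SAWScalingLimit.Theses.SAWLeftRightFKG.LeftRightFKG := by
  intro hC δ c a b a' b' C Ω le hδ ha' hb' haa' hbb' A B hA hB
  exact weight_pa_of_corner SAW.criticalFugacity_pos_lt_one'.1 hC δ c a b a' b' C ⟨hδ, ha', hb', haa', hbb'⟩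
    A B hA hB

end Summit.CriticalPhenomena.SAWScalingLimit.Theorems.LeftRightFKG.CornerLoc

end
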